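import Mathlib.Algebra.Order.Archimedean.Basic
import Summits.PneNP.PneNP.Theorems.PhaseTwinsConstantFactorTwinsEverywhereBase
import Summits.PneNP.PneNP.Theorems.PhaseTwinsConstantFactorTwinsEverywhereParity
import Literature.ModelTheory.FiniteModelTheory.CkEquivTransfer
import Literature.ModelTheory.FiniteModelTheory.CkEquivHomCount
import Summits.PneNP.PneNP.Theses.PhaseTwins

/-!
# Route PhaseTwins, support `ConstantFactorTwinsEverywhere` (stmt-PneNP-2726): the theorem

`constantFactorTwinsEverywhere_proof : Summit.PneNP.PneNP.Theses.PhaseTwins.ConstantFactorTwinsEverywhere`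
— for all `Δ ≥ 3`, `λ > 0` and `k` there are graphs `G`, `H` on the same `n ≥ 1` vertices, both of
maximum degree `≤ Δ`, with `hom(F, G) = hom(F, H)` for every `F` of treewidth `< k`, and
`Z_G(λ) ≥ 2 · Z_H(λ)` (`Z` the hard-core partition function). Assembly of the sibling files:

1. base graph `B = splitGridFin (2k+2)`: connected, maximum degree `3`, every CFI separator has
   `≥ k + 1` vertices (`…Base`);
2. `CFI(B, ∅) ≡_{C^k} CFI(B, {e})` by the tree's Cai–Fürer–Immerman theorem
   `ckEquiv_cfiEven_cfiGraph_of_separator`, both of maximum degree `≤ 3`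
   (`degree_cfiGraph_le_three`: a link over a base vertex of degree `3` has at most two middle
   neighbours with its bit, `card_mids_le_two`);
3. `Z(CFI(B, ∅), λ) ≠ Z(CFI(B, {e}), λ)` (`…Parity`); order the pair so that `Z_P > Z_Q`;
4. `M` disjoint copies with `(Z_P/Z_Q)^M ≥ 2` (`copies`; `ckEquiv_copies` from the tree's
   `CkEquiv.sum`; `Z_{M·P} = Z_P^M` from the tree's `independencePolynomial_gadgetSubst_bot`),
   transported to `Fin n` along `Fintype.equivFin` (`CkEquiv.iso_congr`), and hom counts by the
   tree's Dvořák bridge `Dvorak2010.homCount_eq_of_ckEquiv` (`k ≥ 1`; `k = 0` is vacuous).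
-/

namespace Summit.PneNP.PneNP.PhaseTwins.ConstantFactorTwins

-- `Summit.PneNP.PneNP.…` (summit = sub-problem name) trips the duplicate-namespace linter on every declaration.
set_option linter.dupNamespace false

open Finset
open Literature.ModelTheory.FiniteModelTheory
open Literature.Probability.LatticeModels (independencePolynomial independencePolynomial_pos)
open Literature.Computability.Complexity (independencePolynomial_gadgetSubst_bot)

noncomputable section

/-! ### Disjoint copies -/

section Copies

variable {V : Type*}

/-- **Disjoint copies preserve `C^k`-equivalence.** -/
theorem ckEquiv_copies {W : Type*} {k : ℕ} {H : SimpleGraph V} {H' : SimpleGraph W} (h : CkEquiv k H H') :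
    ∀ N : ℕ, CkEquiv k (copies N H) (copies N H')
  | 0 => CkEquiv.of_iso (copiesZeroIso H H') k
  | N + 1 => (CkEquiv.sum h (ckEquiv_copies h N)).iso_congr (copiesSuccIso N H).symm (copiesSuccIso N H').symm

/-- The degree of a vertex of a copy is its degree. -/
theorem degree_copies [Fintype V] {N : ℕ} (H : SimpleGraph V) [DecidableRel H.Adj] [DecidableRel (copies N H).Adj]
    (a : Fin N × V) : (copies N H).degree a = H.degree a.2 := by
  rw [← SimpleGraph.card_neighborFinset_eq_degree, ← SimpleGraph.card_neighborFinset_eq_degree]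
  have : (copies N H).neighborFinset a = (H.neighborFinset a.2).map ⟨fun x => (a.1, x), fun x y h => by
      simpa using h⟩ := by
    ext ⟨j, y⟩
    simp only [SimpleGraph.mem_neighborFinset, copies_adj, Finset.mem_map, Function.Embedding.coeFn_mk,
      Prod.mk.injEq]
    constructor
    · rintro ⟨h1, h2⟩
      exact ⟨y, h2, h1, rfl⟩
    · rintro ⟨y', h2, h1, rfl⟩
      exact ⟨h1, h2⟩
  rw [this, Finset.card_map]

/-- `Z_{N·H}(λ) = Z_H(λ)^N` (any decidability instances). -/
theorem independencePolynomial_copies [Fintype V] [DecidableEq V] {N : ℕ} (H : SimpleGraph V) [DecidableRel H.Adj]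
    [DecidableRel (copies N H).Adj] (lam : ℝ) :
    independencePolynomial (copies N H) lam = independencePolynomial H lam ^ N := by
  have h := independencePolynomial_gadgetSubst_bot (N := N) H (Function.Embedding.ofIsEmpty (α := Fin 0))
    (Function.Embedding.ofIsEmpty (α := Fin 0)) (Function.Embedding.ofIsEmpty (α := Fin N × Fin 0)) lam
  have h1 : independencePolynomial (copies N H) lam =
      @independencePolynomial _ _ _ (copies N H) (fun a b => Classical.propDecidable _) ℝ _ lam :=
    @independencePolynomial_eq_of_iso _ _ _ _ _ _ (copies N H) (copies N H) _
      (fun a b => Classical.propDecidable _) SimpleGraph.Iso.refl lam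
  have h2 : independencePolynomial H lam =
      @independencePolynomial _ _ _ H (fun a b => Classical.propDecidable _) ℝ _ lam :=
    @independencePolynomial_eq_of_iso _ _ _ _ _ _ H H _ (fun a b => Classical.propDecidable _)
      SimpleGraph.Iso.refl lam
  rw [h1, h2]
  exact h

end Copies

/-! ### CFI graphs over base graphs of maximum degree three have maximum degree three -/

section CFIDegree

variable {v : ℕ} {G : SimpleGraph (Fin v)} [DecidableRel G.Adj]
  {T : Set (Sym2 (Fin v))} [DecidablePred (· ∈ T)]

/-- Over a base vertex of degree `3`, a link has at most two middle neighbours with a given bit. -/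
theorem card_mids_le_two {u w : Fin v} (hw : G.Adj u w) (h3 : G.degree u = 3) (c : Bool) :
    ((univ : Finset {S : Finset (Fin v) // S ⊆ G.neighborFinset u ∧ Even S.card}).filter
      fun S => (c = true ↔ w ∈ S.1)).card ≤ 2 := by
  obtain ⟨w₂, w₃, hw₂, hw₃, h2, h3', h23⟩ := exists_two_other_neighbors w (le_of_eq h3.symm)
  have hN : G.neighborFinset u = {w, w₂, w₃} := by
    symm
    apply Finset.eq_of_subset_of_card_le
    · intro z hz
      simp only [Finset.mem_insert, Finset.mem_singleton] at hz
      rw [SimpleGraph.mem_neighborFinset]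
      rcases hz with rfl | rfl | rfl
      · exact hw
      · exact hw₂
      · exact hw₃
    · rw [SimpleGraph.card_neighborFinset_eq_degree, h3, Finset.card_insert_of_notMem,
        Finset.card_pair h23]
      simp [h2.symm, h3'.symm]
  -- the bit at `w₂` determines a member of the filtered set
  set F := (univ : Finset {S : Finset (Fin v) // S ⊆ G.neighborFinset u ∧ Even S.card}).filter
      fun S => (c = true ↔ w ∈ S.1) with hF
  suffices hinj : Set.InjOn (fun S : {S : Finset (Fin v) // S ⊆ G.neighborFinset u ∧ Even S.card} =>
      decide (w₂ ∈ S.1)) ↑F by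
    calc F.card ≤ (univ : Finset Bool).card :=
          Finset.card_le_card_of_injOn _ (fun _ _ => Finset.mem_coe.2 (Finset.mem_univ _)) hinj
      _ = 2 := by simp
  intro S hS S' hS' heq
  simp only [hF, Finset.coe_filter, Finset.mem_univ, true_and, Set.mem_setOf_eq] at hS hS'
  have hww : w ∈ S.1 ↔ w ∈ S'.1 := hS.symm.trans hS'
  have hw2 : w₂ ∈ S.1 ↔ w₂ ∈ S'.1 := by simpa using heq
  -- if they differed at `w₃`, their cardinalities would differ by one
  have hsub : ∀ (R : {S : Finset (Fin v) // S ⊆ G.neighborFinset u ∧ Even S.card}) (z : Fin v),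
      z ∈ R.1 → z = w ∨ z = w₂ ∨ z = w₃ := fun R z hz => by
    simpa [hN] using R.2.1 hz
  by_contra hne
  have hne' : S.1 ≠ S'.1 := fun h => hne (Subtype.ext h)
  have h3 : ¬ (w₃ ∈ S.1 ↔ w₃ ∈ S'.1) := by
    intro h3
    apply hne'
    ext z
    constructor
    · intro hz
      rcases hsub S z hz with rfl | rfl | rfl
      · exact hww.1 hz
      · exact hw2.1 hz
      · exact h3.1 hz
    · intro hz
      rcases hsub S' z hz with rfl | rfl | rfl
      · exact hww.2 hz
      · exact hw2.2 hz
      · exact h3.2 hz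
  -- wlog `w₃ ∈ S \\ S'`
  have key : ∀ (R R' : {S : Finset (Fin v) // S ⊆ G.neighborFinset u ∧ Even S.card}),
      (w ∈ R.1 ↔ w ∈ R'.1) → (w₂ ∈ R.1 ↔ w₂ ∈ R'.1) → w₃ ∈ R.1 → w₃ ∉ R'.1 → False := by
    intro R R' hw' hw2' hin hout
    have heq : R.1 = insert w₃ R'.1 := by
      ext z
      rw [Finset.mem_insert]
      constructor
      · intro hz
        rcases hsub R z hz with rfl | rfl | rfl
        · exact Or.inr (hw'.1 hz)
        · exact Or.inr (hw2'.1 hz)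
        · exact Or.inl rfl
      · rintro (rfl | hz)
        · exact hin
        · rcases hsub R' z hz with rfl | rfl | rfl
          · exact hw'.2 hz
          · exact hw2'.2 hz
          · exact absurd hz hout
    have hc : R.1.card = R'.1.card + 1 := by rw [heq, Finset.card_insert_of_notMem hout]
    have he := R.2.2
    rw [hc, Nat.even_add_one] at he
    exact he R'.2.2
  by_cases hin : w₃ ∈ S.1
  · exact key S S' hww hw2 hin (fun h => h3 ⟨fun _ => h, fun _ => hin⟩)
  · have hin' : w₃ ∈ S'.1 := by
      by_contra h; exact h3 ⟨fun h' => absurd h' hin, fun h' => absurd h' h⟩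
    exact key S' S hww.symm hw2.symm hin' hin

/-- **`CFI(G, T)` has maximum degree `≤ 3` when `G` has.** -/
theorem degree_cfiGraph_le_three (hG : ∀ u, G.degree u ≤ 3) (x : CFIVertex G) :
    (cfiGraph G T).degree x ≤ 3 := by
  rcases linkV_or_midV x with ⟨⟨d, c⟩, rfl⟩ | ⟨⟨u, S⟩, rfl⟩
  · by_cases h3 : G.degree d.1.1 = 3
    · -- neighbours: the connection partner and the middle vertices with the right bit
      rw [← SimpleGraph.card_neighborFinset_eq_degree]
      have hsub : (cfiGraph G T).neighborFinset (linkV (d, c)) ⊆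
          insert (linkV (conn G T (d, c)))
            (((univ : Finset {S : Finset (Fin v) // S ⊆ G.neighborFinset d.1.1 ∧ Even S.card}).filter
              fun S => (c = true ↔ d.1.2 ∈ S.1)).image fun S => midV ⟨d.1.1, S⟩) := by
        intro y hy
        rw [SimpleGraph.mem_neighborFinset, adj_linkV_iff] at hy
        rw [Finset.mem_insert, Finset.mem_image]
        rcases hy with ⟨S, rfl, hS⟩ | rfl
        · exact Or.inr ⟨S, Finset.mem_filter.2 ⟨Finset.mem_univ _, hS⟩, rfl⟩
        · exact Or.inl rfl
      refine (Finset.card_le_card hsub).trans ((Finset.card_insert_le _ _).trans ?_)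
      have himg : (((univ : Finset {S : Finset (Fin v) // S ⊆ G.neighborFinset d.1.1 ∧ Even S.card}).filter
          fun S => (c = true ↔ d.1.2 ∈ S.1)).image fun S => midV ⟨d.1.1, S⟩).card ≤ 2 :=
        Finset.card_image_le.trans (card_mids_le_two d.2 h3 c)
      omega
    · have h2 : G.degree d.1.1 ≤ 2 := by have := hG d.1.1; omega
      exact (degree_le_two_of_base (T := T) (x := linkV (d, c)) h2).trans (by norm_num)
  · rw [degree_midV]
    exact hG u

end CFIDegree

/-! ### Assembly -/

section Assembly

open scoped Classical

/-- Reading off the conclusion for graphs on `Fin n` ISOMORPHIC to a `C^k`-equivalent pair (stated for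
abstract `G`, `H`, so that every decidability instance in the conclusion is the classical one of the
route statement). -/
theorem twins_of_iso {β : Type*} [Fintype β] [DecidableEq β] {Δ k n : ℕ} (P Q : SimpleGraph β)
    [DecidableRel P.Adj] [DecidableRel Q.Adj] (G H : SimpleGraph (Fin n)) (eG : P ≃g G) (eH : Q ≃g H)
    (hn : 0 < n) (hPQ : CkEquiv k P Q) (hP : ∀ x, P.degree x ≤ Δ) (hQ : ∀ x, Q.degree x ≤ Δ) {lam : ℝ}
    (hZ : 2 * independencePolynomial Q lam ≤ independencePolynomial P lam) :
    ∃ (n : ℕ) (G H : SimpleGraph (Fin n)), 0 < n ∧ G.maxDegree ≤ Δ ∧ H.maxDegree ≤ Δ ∧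
      (∀ (m : ℕ) (F : SimpleGraph (Fin m)), Literature.Combinatorics.SimpleGraph.treewidth F < k →
        Nat.card (F →g G) = Nat.card (F →g H)) ∧
      2 * (∑ I : Finset (Fin n), (if H.IsIndepSet (↑I : Set (Fin n)) then lam ^ I.card else 0)) ≤
        ∑ I : Finset (Fin n), (if G.IsIndepSet (↑I : Set (Fin n)) then lam ^ I.card else 0) := by
  refine ⟨n, G, H, hn, ?_, ?_, ?_, ?_⟩
  · refine SimpleGraph.maxDegree_le_of_forall_degree_le _ _ fun y => ?_
    obtain ⟨a, rfl⟩ := eG.surjective y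
    rw [eG.degree_eq]
    exact hP a
  · refine SimpleGraph.maxDegree_le_of_forall_degree_le _ _ fun y => ?_
    obtain ⟨a, rfl⟩ := eH.surjective y
    rw [eH.degree_eq]
    exact hQ a
  · intro m F hF
    rcases Nat.eq_zero_or_pos k with rfl | hk
    · exact absurd hF (Nat.not_lt_zero _)
    · exact Dvorak2010.homCount_eq_of_ckEquiv hk (hPQ.iso_congr eG eH) F hF
  · have h := hZ
    rw [independencePolynomial_eq_of_iso eG, independencePolynomial_eq_of_iso eH] at h
    simpa only [independencePolynomial] using h

/-- From a `C^k`-equivalent pair with different partition functions to the twins of the statement: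
stack copies, transport to `Fin n`, and read off hom counts through Dvořák's theorem. -/
theorem twins_of_pair {α : Type} [Fintype α] [DecidableEq α] [Nonempty α] {Δ k : ℕ} (P Q : SimpleGraph α)
    [DecidableRel P.Adj] [DecidableRel Q.Adj] (hPQ : CkEquiv k P Q)
    (hP : ∀ x, P.degree x ≤ Δ) (hQ : ∀ x, Q.degree x ≤ Δ) {lam : ℝ}
    (hlam : 0 < lam) (hZ : independencePolynomial Q lam < independencePolynomial P lam) :
    ∃ (n : ℕ) (G H : SimpleGraph (Fin n)), 0 < n ∧ G.maxDegree ≤ Δ ∧ H.maxDegree ≤ Δ ∧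
      (∀ (m : ℕ) (F : SimpleGraph (Fin m)), Literature.Combinatorics.SimpleGraph.treewidth F < k →
        Nat.card (F →g G) = Nat.card (F →g H)) ∧
      2 * (∑ I : Finset (Fin n), (if H.IsIndepSet (↑I : Set (Fin n)) then lam ^ I.card else 0)) ≤
        ∑ I : Finset (Fin n), (if G.IsIndepSet (↑I : Set (Fin n)) then lam ^ I.card else 0) := by
  -- the number of copies
  have hQpos : 0 < independencePolynomial Q lam := independencePolynomial_pos Q hlam.le
  have hr : 1 < independencePolynomial P lam / independencePolynomial Q lam := (one_lt_div hQpos).2 hZ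
  obtain ⟨M, hM⟩ := pow_unbounded_of_one_lt (2 : ℝ) hr
  have hM0 : M ≠ 0 := by
    rintro rfl
    rw [pow_zero] at hM
    norm_num at hM
  have key : 2 * independencePolynomial Q lam ^ M ≤ independencePolynomial P lam ^ M := by
    rw [div_pow, lt_div_iff₀ (pow_pos hQpos M)] at hM
    exact hM.le
  -- transport to `Fin n`
  let e := Fintype.equivFin (Fin M × α)
  refine twins_of_iso (copies M P) (copies M Q) _ _ (SimpleGraph.Iso.map e _) (SimpleGraph.Iso.map e _)
    ?_ (ckEquiv_copies hPQ M) (fun a => (degree_copies P a).le.trans (hP a.2))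
    (fun a => (degree_copies Q a).le.trans (hQ a.2)) ?_
  · rw [Fintype.card_prod, Fintype.card_fin]
    exact Nat.mul_pos (Nat.pos_of_ne_zero hM0) Fintype.card_pos
  · rwa [independencePolynomial_copies, independencePolynomial_copies]

/-- **Route PhaseTwins, support `ConstantFactorTwinsEverywhere` (stmt-PneNP-2726).** For all `Δ ≥ 3`,
`λ > 0` and `k` there are graphs `G`, `H` of maximum degree `≤ Δ` on the same `n ≥ 1` vertices,
homomorphism-indistinguishable over all graphs of treewidth `< k`, with `Z_G(λ) ≥ 2 Z_H(λ)`: disjoint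
copies of the even and the odd Cai–Fürer–Immerman graph over the cubic split grid of side `2k + 2`. -/
theorem constantFactorTwinsEverywhere_proof : Summit.PneNP.PneNP.Theses.PhaseTwins.ConstantFactorTwinsEverywhere := by
  intro Δ hΔ lam hlam k
  -- the base graph and its twisted edge
  obtain ⟨m, hmk⟩ : ∃ m, m = 2 * k + 2 := ⟨_, rfl⟩
  have hm : 0 < m := by omega
  let B := splitGridFin m
  have hconn : B.Connected := connected_splitGridFin hm
  have hsep : ∀ S : Set (Fin (m * (m * 2))), IsCFISeparator B S → k + 1 ≤ S.ncard := by
    intro S hS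
    by_contra hlt
    exact not_isCFISeparator_splitGridFin (k := k) (by omega) S (by omega) hS
  let x₁ : Fin (m * (m * 2)) := sgEquiv m (⟨0, hm⟩, ⟨0, hm⟩, 0)
  let y₁ : Fin (m * (m * 2)) := sgEquiv m (⟨0, hm⟩, ⟨0, hm⟩, 1)
  have hadj : B.Adj x₁ y₁ := by
    show (splitGrid m).Adj ((sgEquiv m).symm (sgEquiv m _)) ((sgEquiv m).symm (sgEquiv m _))
    rw [Equiv.symm_apply_apply, Equiv.symm_apply_apply]
    exact adj_rung _ _
  let T₁ : Set (Sym2 (Fin (m * (m * 2)))) := {s(x₁, y₁)}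
  have hT₁ : ∀ u w, B.Adj u w → (s(u, w) ∈ T₁ ↔ s(u, w) = s(x₁, y₁)) := fun u w _ => Set.mem_singleton_iff
  -- the CFI pair
  have hck : CkEquiv k (cfiEven B) (cfiGraph B T₁) := ckEquiv_cfiEven_cfiGraph_of_separator B hconn hsep hadj T₁ hT₁
  have hZ : independencePolynomial (cfiEven B) lam ≠ independencePolynomial (cfiGraph B T₁) lam :=
    independencePolynomial_cfi_ne hconn hadj T₁ hT₁ hlam
  have hdeg : ∀ u, B.degree u ≤ 3 := fun u => degree_splitGridFin_le u
  have hdegE : ∀ x, (cfiEven B).degree x ≤ Δ := fun x =>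
    (degree_cfiGraph_le_three (T := (∅ : Set (Sym2 (Fin (m * (m * 2)))))) hdeg x).trans hΔ
  have hdegO : ∀ x, (cfiGraph B T₁).degree x ≤ Δ := fun x => (degree_cfiGraph_le_three hdeg x).trans hΔ
  haveI : Nonempty (CFIVertex B) := ⟨midV ⟨x₁, emptyMid B x₁⟩⟩
  rcases lt_or_gt_of_ne hZ with hlt | hgt
  · exact twins_of_pair (cfiGraph B T₁) (cfiEven B) hck.symm hdegO hdegE hlam hlt
  · exact twins_of_pair (cfiEven B) (cfiGraph B T₁) hck hdegE hdegO hlam hgt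

end Assembly

end

end Summit.PneNP.PneNP.PhaseTwins.ConstantFactorTwins
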